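import Summits.Ventures.HSemireg.WedgeKernelGrading
import Summits.Ventures.HSemireg.WedgeHankelFrameChange

/-!
# Venture HSemireg — THE FULL FIBRE DECOMPOSITION of a graded kernel: `Kr(D, η, k) = ⨁_{a} Kr(D, η, k) ∩ Sp(φ = a)` over the finitely many values of an additive support statistic `φ`
# (dimensions add up), for the kernels and images of every `φ`-homogeneous class; the kernel of a NODE class `exp(λΘ)·Θ^p/p!` is graded by the TRANSPORTED `y`-count `Φs λ (planes)`

HONEST FRAMING. Part of the Lean index of the computation cell `pub-hsemireg` (seat p10 gen 19, Sunday typer «UNIFORM-IN-n»).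
Finite-dimensional EXTERIOR ALGEBRA over a field ONLY: no variety, no cohomology theory, no sheaf, no Ext group, no semiregularity map;
nothing here says that HC / HC_CM / HC_AV holds; no Literature fact is declared or used.  Custodian versions as in `WedgeHankelSiegelIdeal` (1/3); the dictionary (`Φs λ E_p` = the class
`exp(λΘ)·Θ^p/p!` of a node `λ` of order `p`; planes = Dolbeault blocks) is QUOTED, never asserted.

WHAT IS IN THE TREE.  I7 `WedgeKernelGrading` (this seat, 949): for an additive support statistic `φ` and a `φ`-homogeneous class `η`, every piece `proj_{φ = a} θ` of a kernel / image
element is again in the kernel / image (`proj_fiber_mem_Kr`, `proj_fiber_mem_V`), the two-piece split `Kr_eq_sup_inf_Sp_fiber`, and the `y`-count instance for the monomial classes `E_p`;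
I5 (947): the SUM identity for `φ = ptype` (`sum_proj_ptype_eq`); E5 `Kr_Φs` (kernels are transported by `Φs λ`), `Φs_w` (`Φs λ (w_n q) = w_n(expMul λ q)`); w3 `finrank_biSup_eq_sum`
(dimensions of disjointly supported pieces add up).  THIS FILE (namespace `Summit.Ventures.HSemireg.Wedge.KernelGrading` continued):
* §190 for ANY statistic `φ` (any generator type `I`): **`sum_proj_fiber_eq`: `Σ_{a ∈ univ.image φ} proj_{φ = a} θ = θ`**; **`eq_biSup_inf_Sp_fiber_of_proj_mem`**: a subspace `W` closed
  under all `proj_{φ = a}` is the sum of its fibre pieces `W = ⨆_a W ⊓ Sp(φ = a)`, and **`finrank_eq_sum_finrank_inf_Sp_fiber`**: `dim W = Σ_a dim (W ⊓ Sp(φ = a))` (the pieces are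
  disjointly supported).
* §191 for `φ` ADDITIVE and `η ∈ Sp(φ = b)`: **`Kr_eq_biSup_inf_Sp_fiber` / `finrank_Kr_eq_sum_fiber`** and **`V_eq_biSup_inf_Sp_fiber` / `finrank_V_eq_sum_fiber`** — the kernel and the image
  of a homogeneous class are the DIRECT SUMS of their fibre pieces, dimensions adding up (every block `D`, degree `k`, field); instances `Kr_w_spike_eq_biSup_ycnt` /
  `finrank_Kr_w_spike_eq_sum_ycnt` (th-7's monomial class `E_p`, the `y`-count: the kernel splits over gen 11's planes and its dimension is the sum of the plane-by-plane dimensions) and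
  `Kr_eq_biSup_ptype_of_Tr` (transversal classes, the pair type — H10 as a finite direct sum, every block `D`).
* §192 THE TWISTED GRADING OF A NODE CLASS: `w_n(expMul λ δ_p) = Φs λ (E_p)` (`w_node_eq_Φs_spike`) and **`Kr_node_eq_biSup_map_Φs`: `Kr(univ, w_n(expMul λ δ_p), k) =
  ⨆_b Φs λ (Kr(univ, E_p, k) ⊓ Sp(ycnt = b))`** (E5's transport of §191): the kernel of a node class of order `p` at `λ` is graded by the transported `y`-count; `finrank_Kr_node_eq_sum_ycnt`.
NOT typed here: the node at `∞` (swap `Ψs`); divisor classes (several nodes: only the pair grading survives); anything Ext-side.  Class side only; new names only.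
-/

open Module

namespace Summit.Ventures.HSemireg.Wedge.KernelGrading

open Summit.Ventures.HSemireg.Wedge Summit.Ventures.HSemireg.Wedge.Kunneth Summit.Ventures.HSemireg.Wedge.Hankel
  Summit.Ventures.HSemireg.Wedge.KunnethKernel Summit.Ventures.HSemireg.Wedge.Weil Summit.Ventures.HSemireg.Wedge.HankelSiegelIdeal
  Summit.Ventures.HSemireg.Wedge.HankelFrameChange

variable (K : Type*) [Field K]

section General

variable {I : Type*} [LinearOrder I] [Fintype I] {A : Type*} [DecidableEq A]

/-! ## §190. The fibre projections sum to the identity; fibre-closed subspaces are direct sums of their pieces -/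

omit [LinearOrder I] in
/-- every support's statistic occurs in `univ.image φ`. -/
lemma mem_image_univ (φ : Finset I → A) (s : Finset I) : φ s ∈ (Finset.univ : Finset (Finset I)).image φ := Finset.mem_image_of_mem _ (Finset.mem_univ s)

/-- **`Σ_{a ∈ univ.image φ} proj_{φ = a} θ = θ`** for every statistic `φ` and every form `θ` (checked on the monomial basis). -/
theorem sum_proj_fiber_eq (φ : Finset I → A) (θ : HT K I) : ∑ a ∈ (Finset.univ : Finset (Finset I)).image φ, proj (K := K) (fun s : Finset I => φ s = a) θ = θ := by
  classical
  have h : (∑ a ∈ (Finset.univ : Finset (Finset I)).image φ, proj (K := K) (fun s : Finset I => φ s = a)) = LinearMap.id := by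
    refine (B K I).ext fun s => ?_
    rw [LinearMap.sum_apply, LinearMap.id_apply]
    simp_rw [proj_B]
    rw [Finset.sum_ite_eq ((Finset.univ : Finset (Finset I)).image φ) (φ s) (fun _ => B K I s), if_pos (mem_image_univ φ s)]
  have h' := LinearMap.congr_fun h θ
  rwa [LinearMap.sum_apply, LinearMap.id_apply] at h'

/-- **A SUBSPACE CLOSED UNDER EVERY FIBRE PROJECTION IS THE SUM OF ITS FIBRE PIECES: `W = ⨆_{a ∈ univ.image φ} W ⊓ Sp(φ = a)`.** -/
theorem eq_biSup_inf_Sp_fiber_of_proj_mem (φ : Finset I → A) {W : Submodule K (HT K I)} (hW : ∀ a, ∀ θ ∈ W, proj (K := K) (fun s : Finset I => φ s = a) θ ∈ W) :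
    W = ⨆ a ∈ (Finset.univ : Finset (Finset I)).image φ, W ⊓ Sp K (fun s : Finset I => φ s = a) := by
  classical
  refine le_antisymm (fun θ hθ => ?_) (iSup₂_le fun a _ => inf_le_left)
  rw [← sum_proj_fiber_eq K φ θ]
  exact Submodule.sum_mem _ fun a ha => Submodule.mem_iSup_of_mem a (Submodule.mem_iSup_of_mem ha ⟨hW a θ hθ, proj_mem _ θ⟩)

/-- **… and the dimensions add up: `dim W = Σ_{a ∈ univ.image φ} dim (W ⊓ Sp(φ = a))`** (the pieces are disjointly supported; w3 `finrank_biSup_eq_sum`). -/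
theorem finrank_eq_sum_finrank_inf_Sp_fiber (φ : Finset I → A) {W : Submodule K (HT K I)} (hW : ∀ a, ∀ θ ∈ W, proj (K := K) (fun s : Finset I => φ s = a) θ ∈ W) :
    finrank K W = ∑ a ∈ (Finset.univ : Finset (Finset I)).image φ, finrank K ↥(W ⊓ Sp K (fun s : Finset I => φ s = a)) := by
  classical
  conv_lhs => rw [eq_biSup_inf_Sp_fiber_of_proj_mem K φ hW]
  exact finrank_biSup_eq_sum _ (fun a => W ⊓ Sp K (fun s : Finset I => φ s = a)) (fun a s => φ s = a) (fun a _ => inf_le_right) (fun a _ b _ hab s ha hb => hab (ha.symm.trans hb))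

end General

section Additive

variable {I : Type*} [LinearOrder I] [Fintype I] {A : Type*} [AddCancelCommMonoid A] [DecidableEq A]

/-! ## §191. Kernels and images of a homogeneous class are the direct sums of their fibre pieces -/

/-- **`Kr(D, η, k) = ⨆_a Kr(D, η, k) ⊓ Sp(φ = a)`** for `φ` additive and `η ∈ Sp(φ = b)` (I7 `proj_fiber_mem_Kr` + §190). -/
theorem Kr_eq_biSup_inf_Sp_fiber {φ : Finset I → A} (hφ : ∀ s t : Finset I, Disjoint s t → φ (s ∪ t) = φ s + φ t) {b : A} {η : HT K I} (hη : η ∈ Sp K (fun s => φ s = b))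
    (D : Finset I) (k : ℕ) : Kr K D η k = ⨆ a ∈ (Finset.univ : Finset (Finset I)).image φ, Kr K D η k ⊓ Sp K (fun s : Finset I => φ s = a) :=
  eq_biSup_inf_Sp_fiber_of_proj_mem K φ fun a _ hθ => proj_fiber_mem_Kr K hφ a hη hθ

/-- **`dim Kr(D, η, k) = Σ_a dim (Kr(D, η, k) ⊓ Sp(φ = a))`.** -/
theorem finrank_Kr_eq_sum_fiber {φ : Finset I → A} (hφ : ∀ s t : Finset I, Disjoint s t → φ (s ∪ t) = φ s + φ t) {b : A} {η : HT K I} (hη : η ∈ Sp K (fun s => φ s = b))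
    (D : Finset I) (k : ℕ) :
    finrank K (Kr K D η k) = ∑ a ∈ (Finset.univ : Finset (Finset I)).image φ, finrank K ↥(Kr K D η k ⊓ Sp K (fun s : Finset I => φ s = a)) :=
  finrank_eq_sum_finrank_inf_Sp_fiber K φ fun a _ hθ => proj_fiber_mem_Kr K hφ a hη hθ

/-- **`V(D, η, k) = ⨆_a V(D, η, k) ⊓ Sp(φ = a)`** (I7 `proj_fiber_mem_V`). -/
theorem V_eq_biSup_inf_Sp_fiber {φ : Finset I → A} (hφ : ∀ s t : Finset I, Disjoint s t → φ (s ∪ t) = φ s + φ t) {b : A} {η : HT K I} (hη : η ∈ Sp K (fun s => φ s = b))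
    (D : Finset I) (k : ℕ) : V K I D η k = ⨆ a ∈ (Finset.univ : Finset (Finset I)).image φ, V K I D η k ⊓ Sp K (fun s : Finset I => φ s = a) :=
  eq_biSup_inf_Sp_fiber_of_proj_mem K φ fun a _ hv => proj_fiber_mem_V K hφ a hη hv

/-- **`dim V(D, η, k) = Σ_a dim (V(D, η, k) ⊓ Sp(φ = a))`.** -/
theorem finrank_V_eq_sum_fiber {φ : Finset I → A} (hφ : ∀ s t : Finset I, Disjoint s t → φ (s ∪ t) = φ s + φ t) {b : A} {η : HT K I} (hη : η ∈ Sp K (fun s => φ s = b))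
    (D : Finset I) (k : ℕ) :
    finrank K (V K I D η k) = ∑ a ∈ (Finset.univ : Finset (Finset I)).image φ, finrank K ↥(V K I D η k ⊓ Sp K (fun s : Finset I => φ s = a)) :=
  finrank_eq_sum_finrank_inf_Sp_fiber K φ fun a _ hv => proj_fiber_mem_V K hφ a hη hv

end Additive

section Instances

variable {N : ℕ}

/-- **the kernel of th-7's MONOMIAL class `E_p = w_m(δ_p)` is the direct sum of its `y`-count pieces** (`p ≤ m ≤ N`; every block, degree, field). -/
theorem Kr_w_spike_eq_biSup_ycnt {m : ℕ} (hm : m ≤ N) {p : ℕ} (hp : p ≤ m) (D : Finset (In N)) (k : ℕ) :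
    Kr K D (w K N m (fun j => if j = p then (1 : K) else 0)) k =
      ⨆ b ∈ (Finset.univ : Finset (Finset (In N))).image (fun s : Finset (In N) => (s.filter fun i : In N => N ≤ (i : ℕ)).card),
        Kr K D (w K N m (fun j => if j = p then (1 : K) else 0)) k ⊓ Sp K (fun s : Finset (In N) => (s.filter fun i : In N => N ≤ (i : ℕ)).card = b) :=
  Kr_eq_biSup_inf_Sp_fiber K (fun _ _ h => ycnt_union h) (w_spike_mem_Sp_ycnt K hm hp) D k

/-- **… and its dimension is the sum of the plane-by-plane dimensions.** -/
theorem finrank_Kr_w_spike_eq_sum_ycnt {m : ℕ} (hm : m ≤ N) {p : ℕ} (hp : p ≤ m) (D : Finset (In N)) (k : ℕ) :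
    finrank K (Kr K D (w K N m (fun j => if j = p then (1 : K) else 0)) k) =
      ∑ b ∈ (Finset.univ : Finset (Finset (In N))).image (fun s : Finset (In N) => (s.filter fun i : In N => N ≤ (i : ℕ)).card),
        finrank K ↥(Kr K D (w K N m (fun j => if j = p then (1 : K) else 0)) k ⊓ Sp K (fun s : Finset (In N) => (s.filter fun i : In N => N ≤ (i : ℕ)).card = b)) :=
  finrank_Kr_eq_sum_fiber K (fun _ _ h => ycnt_union h) (w_spike_mem_Sp_ycnt K hm hp) D k

/-- **H10 as a finite direct sum, every block: `Kr(D, f, k) = ⨆_τ Kr(D, f, k) ⊓ Sp(ptype = τ)`** for a transversal `f`. -/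
theorem Kr_eq_biSup_ptype_of_Tr {f : HT K (In N)} (hf : f ∈ Sp K (Tr (N := N))) (D : Finset (In N)) (k : ℕ) :
    Kr K D f k = ⨆ τ ∈ (Finset.univ : Finset (Finset (In N))).image HankelPairGrading.ptype, Kr K D f k ⊓ Sp K (fun s : Finset (In N) => HankelPairGrading.ptype s = τ) :=
  Kr_eq_biSup_inf_Sp_fiber K (fun _ _ h => HankelPairGrading.ptype_union h) (b := fun _ => 1) (Sp_mono (fun _ hs => HankelPairGrading.ptype_of_Tr hs) hf) D k

/-- the dimension of the kernel of a transversal class is the sum over pair types. -/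
theorem finrank_Kr_eq_sum_ptype_of_Tr {f : HT K (In N)} (hf : f ∈ Sp K (Tr (N := N))) (D : Finset (In N)) (k : ℕ) :
    finrank K (Kr K D f k) = ∑ τ ∈ (Finset.univ : Finset (Finset (In N))).image HankelPairGrading.ptype,
      finrank K ↥(Kr K D f k ⊓ Sp K (fun s : Finset (In N) => HankelPairGrading.ptype s = τ)) :=
  finrank_Kr_eq_sum_fiber K (fun _ _ h => HankelPairGrading.ptype_union h) (b := fun _ => 1) (Sp_mono (fun _ hs => HankelPairGrading.ptype_of_Tr hs) hf) D k

/-! ## §192. The twisted grading of the kernel of a node class -/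

/-- the node class of order `p` at `λ`: `w_n(expMul λ δ_p) = Φs λ (E_p)` (E5 `Φs_w`). -/
theorem w_node_eq_Φs_spike (lam : K) (p : ℕ) :
    w K N N (expMul K lam (fun j => if j = p then (1 : K) else 0)) = Φs K lam (w K N N (fun j => if j = p then (1 : K) else 0)) :=
  (Φs_w K lam le_rfl _).symm

/-- **THE KERNEL OF A NODE CLASS IS GRADED BY THE TRANSPORTED `y`-COUNT: `Kr(univ, w_N(expMul λ δ_p), k) = ⨆_b Φs λ (Kr(univ, E_p, k) ⊓ Sp(ycnt = b))`** (`p ≤ N`; E5's transport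
`Kr_Φs` of §191's decomposition — the pieces are the images under `Φs λ` of the plane pieces of `Kr(univ, E_p, k)`). -/
theorem Kr_node_eq_biSup_map_Φs (lam : K) {p : ℕ} (hp : p ≤ N) (k : ℕ) :
    Kr K Finset.univ (w K N N (expMul K lam (fun j => if j = p then (1 : K) else 0))) k =
      ⨆ b ∈ (Finset.univ : Finset (Finset (In N))).image (fun s : Finset (In N) => (s.filter fun i : In N => N ≤ (i : ℕ)).card),
        (Kr K Finset.univ (w K N N (fun j => if j = p then (1 : K) else 0)) k ⊓ Sp K (fun s : Finset (In N) => (s.filter fun i : In N => N ≤ (i : ℕ)).card = b)).map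
          (Φs K (n := N) lam).toLinearMap := by
  rw [w_node_eq_Φs_spike, Kr_Φs]
  conv_lhs => rw [Kr_w_spike_eq_biSup_ycnt K le_rfl hp Finset.univ k]
  simp only [Submodule.map_iSup]

/-- **… so its dimension is again the sum of the plane-by-plane dimensions of `Kr(univ, E_p, k)`** (transport preserves dimensions). -/
theorem finrank_Kr_node_eq_sum_ycnt (lam : K) {p : ℕ} (hp : p ≤ N) (k : ℕ) :
    finrank K (Kr K Finset.univ (w K N N (expMul K lam (fun j => if j = p then (1 : K) else 0))) k) =
      ∑ b ∈ (Finset.univ : Finset (Finset (In N))).image (fun s : Finset (In N) => (s.filter fun i : In N => N ≤ (i : ℕ)).card),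
        finrank K ↥(Kr K Finset.univ (w K N N (fun j => if j = p then (1 : K) else 0)) k ⊓ Sp K (fun s : Finset (In N) => (s.filter fun i : In N => N ≤ (i : ℕ)).card = b)) := by
  rw [w_node_eq_Φs_spike, Kr_Φs, (Φs K (n := N) lam).toLinearEquiv.finrank_map_eq]
  exact finrank_Kr_w_spike_eq_sum_ycnt K le_rfl hp Finset.univ k

end Instances

end Summit.Ventures.HSemireg.Wedge.KernelGrading
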